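import Summits.BirchSwinnertonDyer.Rank1Residual.X11a.SelmerCompanionTateLineShape
import Summits.BirchSwinnertonDyer.Rank1Residual.X11a.SelmerCompanionResidueCertificate
import HarnessLib

/-!
# Route (3e) SELMER COMPANION, XLII: the residue-field READING of shape G's strictness
# certificate `hcert` (class X11a = N7; cell `b2b-bsdres`, unit `b2b-bsdres-x11a`, gen 33)

HONEST FRAMING (run/shared/lean/b2b/bsd-rank1-residual/, verbatim in every file): the goal of the
cell is to DELETE the COMBINATION-SHAPED residual classes of the Birch–Swinnerton-Dyer formula for
ALL analytic-rank `≤ 1` elliptic curves over `ℚ` — "full BSD formula for every rank `≤ 1` curve in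
class `C`" assembled STRICTLY from published theorems — so that the rank-`≤ 1` remainder becomes
exactly the CONSTRUCTION-SHAPED classes, which are TYPED (missing-input `Prop`s), NOT attempted.
This is not "finishing BSD". CLASS-OWNERS.md: research routes; NO CLAIM BEYOND STATED CLASSES.
THEOREMS ONLY; nothing booked; no label moves.

## What this file proves

Shape G (file XXXV `bsdp_of_bsdp_partner_of_tateLine_certificates`, gen 31) and its shape-F twin
(file XXXVIII, gen 32) take the STRICTNESS certificate at the full-torsion place `v₀ ∤ p` in the
`K̄_v`-level form `hcert`: *for every `p`-th root `c ∈ A(K̄_v)` of the rational point `g` some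
`σ ∈ Γ_{ℚ_v}` moves `c` off the transported Tate line `Λ = θΦ'(μ_p)`*. The census decides instead,
in the reduction `Ã` of the minimal model of `A` (good at `v`), that `Frob(μ) − μ ∉ Λ̃` for the
`p`-th roots `μ` of `g̃` (`HOME/code/b2b-bsdres-x11a/gen31/…/linestrict*.gp`, two engines). This
file proves, through the tree's reduction map `red₀ : A(K̄_v) → Ã(𝒪_w/𝔪_w)` of the minimal model
(`OrdinaryLocalReductionMapProofs`, pinned down by `hred₀`) — exactly as file XXIII did for the
certificates of files XXI/XXII —

* `localRed_smul_frobenius` (§1) — **reduction commutes with Frobenius**: for an arithmetic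
  Frobenius `τ ∈ Γ_{ℚ_v}` (`τz ≡ z^q`) and a `w`-integral point `c = (x, y) ∈ A(K̄_v)`,
  `red₀ c = (x̄, ȳ)` and `red₀ (τc) = (x̄^q, ȳ^q)` (`exists_residueMap`: the residue map is
  Frobenius-compatible; `reducePoint_congrEquiv_some_of_val_le_one`);
* `hcert_of_tateLine_residue_certificate` (§2) — **the strictness certificate of shape G, residue
  form**: if `g̃ := red₀ g ≠ O` and NO point `c̃ = (a, b)` of `Ã` over the residue field with
  `p·c̃ = g̃` has `(a^q, b^q) − (a, b) ∈ red₀(Λ)`, then `hcert` holds verbatim (take `σ = τ`: a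
  root `c` with `τc − c = λ ∈ Λ` is integral since `g̃ ≠ O`, and reduces to such a `c̃`).

So the `K̄_v`-level quantifier over the roots `c` is replaced by the residue-level statement the
engines compute (they find one cube root `μ` of `g̃` over `𝔽_{ℓ³}` and use `Ã[3] ⊂ Ã(𝔽_ℓ)` to
cover all nine); `Λ̃ = red₀(Λ)` stays tied to the equivariant `θ` of the row (the engines make `θ`
explicit; this file does not). Binders: none new. Not a class theorem; nothing booked.

References: [SilvermanAEC2009] VII.2.1, VII.§2; [GreenbergLNM1716] §2 p. 70; [SerreLocalFields1979]
IV §4; files XXIII, XXXIV, XXXV, XXXVIII; HOME/b2b-bsdres-x11a/REPORT-g33.md.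
-/

set_option autoImplicit false

noncomputable section

open scoped Classical NNReal

open WeierstrassCurve Literature.NumberTheory.EllipticCurves
  Literature.NumberTheory.GaloisRepresentations Field NumberField IsDedekindDomain
  IsDedekindDomain.HeightOneSpectrum Literature.NumberTheory.EllipticCurves.FormalGroupChart
  Literature.NumberTheory.EllipticCurves.Rank1Residual
  Literature.NumberTheory.EllipticCurves.Rank1Residual.Typed

namespace Summit.BirchSwinnertonDyer.Rank1Residual.X11a.SelmerCompanion

variable (A : WeierstrassCurve ℚ) [A.IsGloballyMinimal] (p : ℕ) [hp : Fact p.Prime]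
  {v : HeightOneSpectrum (𝓞 ℚ)}
  {w : Valuation (AlgebraicClosure (v.adicCompletion ℚ)) ℝ≥0}
  (hw : ∀ x, (w x : ℝ) = spectralNorm (v.adicCompletion ℚ) (AlgebraicClosure (v.adicCompletion ℚ)) x)
  (hΔu : IsUnit ((integralModelInt A).map (algebraMap ℤ ↥w.valuationSubring)).Δ)
  (red₀ : localPoints A (v.adicCompletion ℚ) →+
    (((integralModelInt A).map (algebraMap ℤ ↥w.valuationSubring)).map
      (IsLocalRing.residue ↥w.valuationSubring)).toAffine.Point)
  (hred₀ : ∀ P : localPoints A (v.adicCompletion ℚ), red₀ P =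
    ((integralModelInt A).map (algebraMap ℤ ↥w.valuationSubring)).reducePoint
      (Affine.Point.congrEquiv (localIntModel_baseChange A w.valuationSubring).symm P))

/-! ## §1 Reduction commutes with an arithmetic Frobenius -/

include hw hΔu hred₀ in
/-- **`red₀ (τc) = Frob(red₀ c)` for a `w`-integral point.** Let `τ ∈ Γ_{ℚ_v}` be an arithmetic
Frobenius at a prime `𝔐` of `\bar ℤ_v` (`τz ≡ z^q (mod 𝔐)`, `q = #k_v`) and `c = (x, y) ∈ A(K̄_v)`
with `w x ≤ 1`. Then `w y ≤ 1`, `red₀ c = (x̄, ȳ)` and `red₀ (τc) = (x̄^q, ȳ^q)` in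
`Ã(𝒪_w/𝔪_w)`, `Ã` the reduction of the minimal model (`hΔu`: unit discriminant). PROOF: `τc =
(τx, τy)` with `w(τx) = w x` (`τ` is an isometry); the residue map `r : 𝒪_w → k̄_v` of
`exists_residueMap` has kernel `𝔪_w` and satisfies `r(τz) = r(z)^q`, so `τz ≡ z^q (mod 𝔪_w)`.
Silverman, *AEC*, VII.§2; Serre, *Local Fields*, IV §4. [cite: SilvermanAEC2009, Prop. VII.2.1]
[cite: SerreLocalFields1979, Ch. IV §4 Prop. 16] -/
theorem localRed_smul_frobenius {𝔐 : Ideal v.localAbsIntegers} (h𝔐 : 𝔐 ∈ v.localPrimesAbove)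
    {τ : absoluteGaloisGroup (v.adicCompletion ℚ)}
    (hτ : IsArithFrobAt (v.adicCompletionIntegers ℚ) τ 𝔐)
    {x y : AlgebraicClosure (v.adicCompletion ℚ)}
    {h : (A.baseChange (AlgebraicClosure (v.adicCompletion ℚ))).toAffine.Nonsingular x y}
    (hx : w x ≤ 1) :
    ∃ (hy : w y ≤ 1)
      (hns : (((integralModelInt A).map (algebraMap ℤ ↥w.valuationSubring)).map
        (IsLocalRing.residue ↥w.valuationSubring)).toAffine.Nonsingular
        (IsLocalRing.residue ↥w.valuationSubring ⟨x, hx⟩)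
        (IsLocalRing.residue ↥w.valuationSubring ⟨y, hy⟩))
      (hnsq : (((integralModelInt A).map (algebraMap ℤ ↥w.valuationSubring)).map
        (IsLocalRing.residue ↥w.valuationSubring)).toAffine.Nonsingular
        (IsLocalRing.residue ↥w.valuationSubring ⟨x, hx⟩ ^
          Nat.card (IsLocalRing.ResidueField (v.adicCompletionIntegers ℚ)))
        (IsLocalRing.residue ↥w.valuationSubring ⟨y, hy⟩ ^
          Nat.card (IsLocalRing.ResidueField (v.adicCompletionIntegers ℚ)))),
      red₀ (Affine.Point.some x y h) = .some _ _ hns ∧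
      red₀ (τ • (show localPoints A (v.adicCompletion ℚ) from Affine.Point.some x y h)) =
        .some _ _ hnsq := by
  have hvO : w.Integers w.valuationSubring := Valuation.valuationSubring.integers w
  have hMK := localIntModel_baseChange A w.valuationSubring
  set q := Nat.card (IsLocalRing.ResidueField (v.adicCompletionIntegers ℚ)) with hq
  obtain ⟨r, hr, -, hrF⟩ := exists_residueMap (v := v) hw h𝔐
  -- `red₀ c = (x̄, ȳ)`
  obtain ⟨hy, hns, e⟩ := reducePoint_congrEquiv_some_of_val_le_one hΔu hMK x y h hx
  -- `τ • (x, y) = (τx, τy)`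
  have hτx : w (τ • x) ≤ 1 := by rwa [spectralValuation_smul hw]
  obtain ⟨h₂, hτP⟩ : ∃ h₂, τ • (show localPoints A (v.adicCompletion ℚ) from
      Affine.Point.some x y h) = Affine.Point.some (τ • x) (τ • y) h₂ :=
    ⟨_, by rw [localPoints.smul_def, Affine.Point.map_some]; rfl⟩
  obtain ⟨hτy, hns₂, e₂⟩ := reducePoint_congrEquiv_some_of_val_le_one hΔu hMK (τ • x) (τ • y) h₂ hτx
  -- `τz ≡ z^q (mod 𝔪_w)`
  have key : ∀ (z : AlgebraicClosure (v.adicCompletion ℚ)) (hz : w z ≤ 1) (hτz : w (τ • z) ≤ 1),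
      IsLocalRing.residue ↥w.valuationSubring ⟨τ • z, hτz⟩ =
        IsLocalRing.residue ↥w.valuationSubring ⟨z, hz⟩ ^ q := by
    intro z hz hτz
    rw [← map_pow]
    apply Ideal.Quotient.eq.mpr
    rw [IsLocalRing.mem_maximalIdeal, mem_nonunits_iff, hvO.isUnit_iff_valuation_eq_one]
    have h0 : r (⟨τ • z, hτz⟩ - ⟨z, hz⟩ ^ q) = 0 := by
      rw [map_sub, map_pow, hrF hτ ⟨z, hz⟩ hτz, sub_self]
    rw [hr] at h0
    exact ne_of_lt h0
  have hyq : w (τ • y) ≤ 1 := by rwa [spectralValuation_smul hw]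
  have ex : IsLocalRing.residue ↥w.valuationSubring ⟨τ • x, hτx⟩ =
      IsLocalRing.residue ↥w.valuationSubring ⟨x, hx⟩ ^ q := key x hx hτx
  have ey : IsLocalRing.residue ↥w.valuationSubring ⟨τ • y, hτy⟩ =
      IsLocalRing.residue ↥w.valuationSubring ⟨y, hy⟩ ^ q := key y hy hτy
  have hnsq : (((integralModelInt A).map (algebraMap ℤ ↥w.valuationSubring)).map
      (IsLocalRing.residue ↥w.valuationSubring)).toAffine.Nonsingular
      (IsLocalRing.residue ↥w.valuationSubring ⟨x, hx⟩ ^ q)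
      (IsLocalRing.residue ↥w.valuationSubring ⟨y, hy⟩ ^ q) := by
    rw [← ex, ← ey]; exact hns₂
  refine ⟨hy, hns, hnsq, ?_, ?_⟩
  · rw [hred₀]; exact e
  · rw [hτP, hred₀, e₂]
    simp only [Affine.Point.some.injEq]
    exact ⟨ex, ey⟩

/-! ## §2 The strictness certificate of shape G from the residue field -/

omit hp in
include hw hΔu hred₀ in
/-- **Shape G's `hcert` from the residue field.** Setting of file XXXV at the full-torsion place
`v ∤ p` (`A` good at `v`: `hΔu`; `E = W` with its Tate datum `Φ'`; `θ : E[p] ≃ A[p]`); write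
`λ(ζ) := θ(Φ'(ζ)) ∈ A(K̄_v)` for `ζ ∈ μ_p` (the transported Tate line `Λ`) and `g̃ := red₀ g` for
the rational point `g ∈ A(ℚ)` read in `A(K̄_v)`. HYPOTHESES (the census computation): `g̃ ≠ O`
(`h0`), and for every affine point `c̃ = (a, b)` of `Ã` over the residue field with `p·c̃ = g̃`
and every `ζ ∈ μ_p`, `(a^q, b^q) − (a, b) ≠ red₀ λ(ζ)` (`hres`; `q = #k_v`). CONCLUSION: the
hypothesis `hcert` of `bsdp_of_bsdp_partner_of_tateLine_certificates` (file XXXV) and of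
`bsdp_of_auxiliary_of_tateLine_certificates` (file XXXVIII) verbatim — for every `c ∈ A(K̄_v)`
with `p c = g` some `σ ∈ Γ_{ℚ_v}` has `σc − c ≠ λ(ζ)` for all `ζ`. PROOF: `σ = τ` an arithmetic
Frobenius (`exists_isArithFrobAt_localAbsIntegers`); if `τc − c = λ(ζ)` then `c` is integral
(`c ∈ A₁ = ker red₀` would give `g̃ = p·red₀ c = O`), and §1 turns `red₀` of the identity into
`(x̄^q, ȳ^q) − (x̄, ȳ) = red₀ λ(ζ)` with `p·(x̄, ȳ) = g̃`, contradicting `hres`.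
[cite: SilvermanAEC2009, Prop. VII.2.1] [cite: GreenbergLNM1716, §2 p. 70] -/
theorem hcert_of_tateLine_residue_certificate
    [hV : (A.baseChange (AlgebraicClosure (v.adicCompletion ℚ))).IsIntegral w.integer]
    (W : WeierstrassCurve ℚ) [W.IsElliptic] (hn : (p : ℤ) ≠ 0)
    (θ : geomTorsion W (p : ℤ) ≃+ geomTorsion A (p : ℤ))
    (Φ' : Additive (AlgebraicClosure (v.adicCompletion ℚ))ˣ →+ localPoints W (v.adicCompletion ℚ))
    (g : A.toAffine.Point)
    (h0 : red₀ (pointsMap A (v.adicCompletion ℚ) (toGeomPoints A g)) ≠ 0)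
    (hres : ∀ (a b : IsLocalRing.ResidueField ↥w.valuationSubring)
        (hab : (((integralModelInt A).map (algebraMap ℤ ↥w.valuationSubring)).map
          (IsLocalRing.residue ↥w.valuationSubring)).toAffine.Nonsingular a b)
        (habq : (((integralModelInt A).map (algebraMap ℤ ↥w.valuationSubring)).map
          (IsLocalRing.residue ↥w.valuationSubring)).toAffine.Nonsingular
          (a ^ Nat.card (IsLocalRing.ResidueField (v.adicCompletionIntegers ℚ)))
          (b ^ Nat.card (IsLocalRing.ResidueField (v.adicCompletionIntegers ℚ)))),
      (p : ℤ) • (Affine.Point.some a b hab) = red₀ (pointsMap A (v.adicCompletion ℚ)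
        (toGeomPoints A g)) →
      ∀ (ζ : (AlgebraicClosure (v.adicCompletion ℚ))ˣ), ζ ^ p = 1 →
        ∀ hζ : Φ' (Additive.ofMul ζ) ∈
            AddSubgroup.torsionBy (localPoints W (v.adicCompletion ℚ)) (p : ℤ),
          (Affine.Point.some _ _ habq) - (Affine.Point.some a b hab) ≠
            red₀ (pointsMap A (v.adicCompletion ℚ)
              ((θ ((W.torsionPointsEquiv (p : ℤ) (E := v.adicCompletion ℚ) hn).symm
                ⟨Φ' (Additive.ofMul ζ), hζ⟩) : geomTorsion A (p : ℤ)) : geomPoints A))) :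
    ∀ c : localPoints A (v.adicCompletion ℚ),
      (p : ℤ) • c = pointsMap A (v.adicCompletion ℚ) (toGeomPoints A g) →
      ∃ σ : absoluteGaloisGroup (v.adicCompletion ℚ),
        ∀ (ζ : (AlgebraicClosure (v.adicCompletion ℚ))ˣ), ζ ^ p = 1 →
        ∀ hζ : Φ' (Additive.ofMul ζ) ∈
            AddSubgroup.torsionBy (localPoints W (v.adicCompletion ℚ)) (p : ℤ),
          σ • c - c ≠ pointsMap A (v.adicCompletion ℚ)
            ((θ ((W.torsionPointsEquiv (p : ℤ) (E := v.adicCompletion ℚ) hn).symm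
              ⟨Φ' (Additive.ofMul ζ), hζ⟩) : geomTorsion A (p : ℤ)) : geomPoints A) := by
  obtain ⟨𝔐, h𝔐⟩ := v.localPrimesAbove_nonempty
  obtain ⟨τ, hτ⟩ := v.exists_isArithFrobAt_localAbsIntegers h𝔐
  intro c hc
  refine ⟨τ, fun ζ hζp hζ heq ↦ ?_⟩
  -- `c` is integral: otherwise `red₀ c = 0` and `g̃ = p • red₀ c = 0`
  have hredg : red₀ (pointsMap A (v.adicCompletion ℚ) (toGeomPoints A g)) = (p : ℤ) • red₀ c := by
    rw [← hc, map_zsmul]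
  have hc0 : red₀ c ≠ 0 := fun h' ↦ h0 (by rw [hredg, h', zsmul_zero])
  have hcK : ((c : localPoints A (v.adicCompletion ℚ)) :
      (A.baseChange (AlgebraicClosure (v.adicCompletion ℚ))).toAffine.Point) ∉
      kernel w (A.baseChange (AlgebraicClosure (v.adicCompletion ℚ))) :=
    fun hk ↦ hc0 ((A.localRed_eq_zero_iff_mem_kernel hΔu red₀ hred₀ c).mpr hk)
  change (A.baseChange (AlgebraicClosure (v.adicCompletion ℚ))).toAffine.Point at c
  rcases c with _ | ⟨x, y, h⟩
  · exact hc0 (map_zero red₀)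
  have hx : w x ≤ 1 := by
    by_contra hx
    exact hcK ((some_mem_kernel_iff (w := w) h).mpr (not_le.mp hx))
  obtain ⟨hy, hns, hnsq, e₁, e₂⟩ := localRed_smul_frobenius A hw hΔu red₀ hred₀ h𝔐 hτ (h := h) hx
  -- reduce the identity `τc − c = λ(ζ)`
  have hred := congrArg red₀ heq
  rw [map_sub, e₁, e₂] at hred
  rw [e₁] at hredg
  exact hres _ _ hns hnsq hredg.symm ζ hζp hζ hred

end Summit.BirchSwinnertonDyer.Rank1Residual.X11a.SelmerCompanion

end
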